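import Summits.KontsevichZagierPeriods.KontsevichZagierPeriods.Theorems.LinRedNormalFormDihedralNormalFormStubExactToFacesTwoAux2

/-!
# Stub `stub_exactToFacesTwo` of line `tame-bv-stokes` (crux `DihedralNormalForm`) — tools IV

Support file for the stub `stub_exactToFacesTwo`: the reductions of pole order `≤ 1`. With the
abbreviation (docstrings only) `GEN(k, a, b, P, R, m) = fun x => k x₀^a x₁^b (1-x₀)^P (1-x₁)^R
(1-x₀x₁)^m` of tools I, and "`g` is GOOD" for "every representation of `g` on the open square lies
in `G`" (tools II), for a subgroup `G ⊇ relations` containing the cubical atoms of dimension one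
and the `ζ(2)` words `[Δ₂, q/(t₀(1-t₁))]`:

* `facesTwo_rep_gen`, `facesTwo_rep_add`, `facesTwo_rep_sub`: representability of atoms and of
  sums/differences on the open square;
* `facesTwo_good_swap`: the symmetry `x₀ ↔ x₁` (one re-indexing move) exchanges `(a, P)` and
  `(b, R)`;
* `facesTwo_good_poly`: polynomial atoms (`m ≥ 0`) are GOOD — induction on `m + P`, one Stokes
  move with primitive `GEN(q/(a+1), a+1, b, P, R, m)` in direction `x₀` per step;
* `facesTwo_good_T0`: `q/(1-x₀x₁)` is GOOD — the cubical chart to the `ζ(2)` word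
  (`TwoPosets.stub_cubicalChart`); registered sub-goal `stub_exactToFacesTwoAux4`;
* `facesTwo_good_T`: `T_c = q x₀^c/(1-x₀x₁)` is GOOD — induction on `c`, one Stokes move with the
  two primitives `A = k x₀^c(1-x₀)/(1-x₀x₁)`, `B = k x₀^{c-1}(1-x₁)/(1-x₀x₁)`, `k = -q/c`, whose
  divergence is `q T_c + (q(1-c)/c) T_{c-1}`;
* `facesTwo_good_W`, `facesTwo_good_m1`: all atoms of pole order one, `q x₀^a x₁^b (1-x₀)^P
  (1-x₁)^R/(1-x₀x₁)`, are GOOD — the algebraic identities `x₀x₁ = 1 - (1-x₀x₁)`,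
  `(1-x)^{P+1} = (1-x)^P - x(1-x)^P` (integrand additivity) and the symmetry `x₀ ↔ x₁`.

References: M. Kontsevich, D. Zagier, *Periods* (2001), §1.2.
-/

noncomputable section

open MeasureTheory Set
open Literature.NumberTheory.Transcendental
open Literature.ModelTheory.ExponentialFields (IsSemialgebraic)
open Summit.KontsevichZagierPeriods.MzvKernelInKZ.Negative
open Summit.KontsevichZagierPeriods.MzvKernelInKZ.TwoPosets

namespace Summit.KontsevichZagierPeriods.DihedralNormalForm.TameBVStokes

/-! ### The standing hypotheses (as in tools II, plus `hL`: the `ζ(2)` words lie in `G`) -/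

variable (hStokes : ∀ (k : ℕ) (h : Fin (k + 1) → (Fin (k + 1) → ℝ) → ℝ) (C : ℝ)
    (r : Literature.NumberTheory.Transcendental.KZ.IntegralRep (k + 1))
    (f₀ f₁ : Fin (k + 1) → Literature.NumberTheory.Transcendental.KZ.IntegralRep k),
    (∀ i, Literature.NumberTheory.Transcendental.IsSemialgebraicFunOn ℚ
      {x : Fin (k + 1) → ℝ | ∀ i, x i ∈ Set.Icc (0:ℝ) 1} (h i)) →
    (∀ i, ∀ x ∈ {x : Fin (k + 1) → ℝ | ∀ i, x i ∈ Set.Ioo (0:ℝ) 1}, |h i x| ≤ C) →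
    (∀ i, ∀ x ∈ {x : Fin (k + 1) → ℝ | ∀ i, x i ∈ Set.Ioo (0:ℝ) 1},
      DifferentiableAt ℝ (h i) x) →
    (∀ i, ∀ y ∈ {x : Fin k → ℝ | ∀ i, x i ∈ Set.Ioo (0:ℝ) 1},
      ContinuousOn (fun t : ℝ => h i (Fin.insertNth i t y)) (Set.Icc 0 1)) →
    r.domain = {x : Fin (k + 1) → ℝ | ∀ i, x i ∈ Set.Ioo (0:ℝ) 1} →
    Set.EqOn r.integrand (fun x => ∑ i, fderiv ℝ (h i) x (Pi.single i 1)) r.domain →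
    (∀ i, (f₀ i).domain = {x : Fin k → ℝ | ∀ i, x i ∈ Set.Ioo (0:ℝ) 1} ∧
      (f₁ i).domain = {x : Fin k → ℝ | ∀ i, x i ∈ Set.Ioo (0:ℝ) 1} ∧
      Set.EqOn (f₀ i).integrand (fun y => h i (Fin.insertNth i 0 y))
        {x : Fin k → ℝ | ∀ i, x i ∈ Set.Ioo (0:ℝ) 1} ∧
      Set.EqOn (f₁ i).integrand (fun y => h i (Fin.insertNth i 1 y))
        {x : Fin k → ℝ | ∀ i, x i ∈ Set.Ioo (0:ℝ) 1}) →
    Literature.NumberTheory.Transcendental.KZ.of r -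
        ∑ i, (Literature.NumberTheory.Transcendental.KZ.of (f₁ i) -
          Literature.NumberTheory.Transcendental.KZ.of (f₀ i)) ∈
      Literature.NumberTheory.Transcendental.KZ.relations)
  {G : AddSubgroup KZ.FormalRep} (hG : KZ.relations ≤ G)
  (hC1 : ∀ (f : KZ.IntegralRep 1) (q : ℚ) (a e : ℕ), f.domain = KZ.unitCube 1 →
    Set.EqOn f.integrand (fun y => (q : ℝ) * (y 0 ^ a * (1 - y 0) ^ e)) (KZ.unitCube 1) →
    KZ.of f ∈ G)
  (hL : ∀ q : ℚ, KZ.of (wordRep ω2 q adm_ω2) ∈ G)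

/-! ### Representability on the open square -/

/-- Representations of a function from its semialgebraicity and integrability. -/
theorem facesTwo_rep_of {g : (Fin 2 → ℝ) → ℝ} (hsa : IsSemialgebraicFunOn ℚ (KZ.unitCube 2) g)
    (hint : IntegrableOn g (KZ.unitCube 2)) :
    ∃ r : KZ.IntegralRep 2, r.domain = KZ.unitCube 2 ∧ Set.EqOn r.integrand g (KZ.unitCube 2) :=
  ⟨⟨KZ.unitCube 2, g, KZ.isSemialgebraic_unitCube 2, hsa, hint⟩, rfl, fun _ _ => rfl⟩

/-- `GEN` is representable as soon as `m ≥ -(P + R + 1)`. -/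
theorem facesTwo_rep_gen (k : ℚ) (a b P R : ℕ) (m : ℤ) (h : -((P : ℤ) + R + 1) ≤ m) :
    ∃ r : KZ.IntegralRep 2, r.domain = KZ.unitCube 2 ∧ Set.EqOn r.integrand (fun x => (k : ℝ) *
      (x 0 ^ a * x 1 ^ b * (1 - x 0) ^ P * (1 - x 1) ^ R * (1 - x 0 * x 1) ^ m)) (KZ.unitCube 2) :=
  facesTwo_rep_of (facesTwo_gen_sa_Q2 k a b P R m) (facesTwo_gen_integrableOn k a b P R m h)

/-- Sums of representable functions are representable. -/
theorem facesTwo_rep_add {g₁ g₂ : (Fin 2 → ℝ) → ℝ}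
    (h₁ : ∃ r : KZ.IntegralRep 2, r.domain = KZ.unitCube 2 ∧ Set.EqOn r.integrand g₁ (KZ.unitCube 2))
    (h₂ : ∃ r : KZ.IntegralRep 2, r.domain = KZ.unitCube 2 ∧ Set.EqOn r.integrand g₂ (KZ.unitCube 2)) :
    ∃ r : KZ.IntegralRep 2, r.domain = KZ.unitCube 2 ∧
      Set.EqOn r.integrand (fun x => g₁ x + g₂ x) (KZ.unitCube 2) := by
  obtain ⟨r₁, h₁d, h₁i⟩ := h₁
  obtain ⟨r₂, h₂d, h₂i⟩ := h₂
  have hs₁ := r₁.isSemialgebraicFunOn_integrand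
  have hs₂ := r₂.isSemialgebraicFunOn_integrand
  have hi₁ := r₁.integrableOn
  have hi₂ := r₂.integrableOn
  rw [h₁d] at hs₁ hi₁
  rw [h₂d] at hs₂ hi₂
  refine ⟨⟨KZ.unitCube 2, fun x => r₁.integrand x + r₂.integrand x, KZ.isSemialgebraic_unitCube 2,
    hs₁.fun_add hs₂, hi₁.add hi₂⟩, rfl, fun x hx => ?_⟩
  show r₁.integrand x + r₂.integrand x = g₁ x + g₂ x
  rw [h₁i hx, h₂i hx]

/-- Differences of representable functions are representable. -/
theorem facesTwo_rep_sub {g₁ g₂ : (Fin 2 → ℝ) → ℝ}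
    (h₁ : ∃ r : KZ.IntegralRep 2, r.domain = KZ.unitCube 2 ∧ Set.EqOn r.integrand g₁ (KZ.unitCube 2))
    (h₂ : ∃ r : KZ.IntegralRep 2, r.domain = KZ.unitCube 2 ∧ Set.EqOn r.integrand g₂ (KZ.unitCube 2)) :
    ∃ r : KZ.IntegralRep 2, r.domain = KZ.unitCube 2 ∧
      Set.EqOn r.integrand (fun x => g₁ x - g₂ x) (KZ.unitCube 2) := by
  obtain ⟨r₁, h₁d, h₁i⟩ := h₁
  obtain ⟨r₂, h₂d, h₂i⟩ := h₂
  have hs₁ := r₁.isSemialgebraicFunOn_integrand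
  have hs₂ := r₂.isSemialgebraicFunOn_integrand
  have hi₁ := r₁.integrableOn
  have hi₂ := r₂.integrableOn
  rw [h₁d] at hs₁ hi₁
  rw [h₂d] at hs₂ hi₂
  refine ⟨⟨KZ.unitCube 2, fun x => r₁.integrand x - r₂.integrand x, KZ.isSemialgebraic_unitCube 2,
    hs₁.fun_sub hs₂, hi₁.sub hi₂⟩, rfl, fun x hx => ?_⟩
  show r₁.integrand x - r₂.integrand x = g₁ x - g₂ x
  rw [h₁i hx, h₂i hx]

/-! ### The symmetry `x₀ ↔ x₁` -/

include hG in
/-- **Symmetry** `x₀ ↔ x₁`: GOOD for `GEN(k, a, b, P, R, m)` gives GOOD for `GEN(k, b, a, R, P, m)`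
(one re-indexing move, `KZ.of_sub_of_reindex_mem_relations`).
[cite: KontsevichZagier2001, §1.2 rule (2)] -/
theorem facesTwo_good_swap (k : ℚ) (a b P R : ℕ) (m : ℤ)
    (h : ∀ r : KZ.IntegralRep 2, r.domain = KZ.unitCube 2 → Set.EqOn r.integrand (fun x => (k : ℝ) *
      (x 0 ^ a * x 1 ^ b * (1 - x 0) ^ P * (1 - x 1) ^ R * (1 - x 0 * x 1) ^ m)) (KZ.unitCube 2) →
      KZ.of r ∈ G) :
    ∀ r : KZ.IntegralRep 2, r.domain = KZ.unitCube 2 → Set.EqOn r.integrand (fun x => (k : ℝ) *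
      (x 0 ^ b * x 1 ^ a * (1 - x 0) ^ R * (1 - x 1) ^ P * (1 - x 0 * x 1) ^ m)) (KZ.unitCube 2) →
      KZ.of r ∈ G := by
  intro r hrd hri
  have h1 := KZ.of_sub_of_reindex_mem_relations r (Equiv.swap (0 : Fin 2) 1)
  have hsw : ∀ w : Fin 2 → ℝ, w ∈ KZ.unitCube 2 ↔
      (fun i => w (Equiv.swap (0 : Fin 2) 1 i)) ∈ KZ.unitCube 2 := by
    intro w
    simp only [KZ.unitCube, mem_setOf_eq, Fin.forall_fin_two, Equiv.swap_apply_left,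
      Equiv.swap_apply_right]
    exact and_comm
  have h2 : KZ.of (r.reindex (Equiv.swap (0 : Fin 2) 1)) ∈ G := by
    refine h _ ?_ fun w hw => ?_
    · show {w : Fin 2 → ℝ | (fun i => w (Equiv.swap (0 : Fin 2) 1 i)) ∈ r.domain} = KZ.unitCube 2
      ext w
      rw [hrd, mem_setOf_eq, ← hsw w]
    · show r.integrand (fun i => w (Equiv.swap (0 : Fin 2) 1 i)) =
        (k : ℝ) * (w 0 ^ a * w 1 ^ b * (1 - w 0) ^ P * (1 - w 1) ^ R * (1 - w 0 * w 1) ^ m)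
      have hw' : (fun i => w (Equiv.swap (0 : Fin 2) 1 i)) ∈ KZ.unitCube 2 := (hsw w).1 hw
      rw [hri hw']
      simp only [Equiv.swap_apply_left, Equiv.swap_apply_right]
      rw [mul_comm (w 1) (w 0)]
      ring
  have e : KZ.of r = (KZ.of r - KZ.of (r.reindex (Equiv.swap (0 : Fin 2) 1))) +
      KZ.of (r.reindex (Equiv.swap (0 : Fin 2) 1)) := by abel
  rw [e]
  exact add_mem (hG h1) h2

/-! ### Polynomial atoms -/

include hStokes hG hC1 in
/-- **Polynomial atoms are GOOD** (`m = M ≥ 0`): induction on `M + P`. One Stokes move in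
direction `x₀` with primitive `h₀ = GEN(q/(a+1), a+1, b, P, R, M)`:
`∂₀h₀ = GEN(q, a, b, P, R, M) - GEN(qP/(a+1), a+1, b, P-1, R, M) - GEN(qM/(a+1), a+1, b+1, P, R, M-1)`,
the two remainders having smaller `M + P` (or a vanishing coefficient).
[cite: KontsevichZagier2001, §1.2 rule (3)] -/
theorem facesTwo_good_poly : ∀ (n M P a b R : ℕ) (q : ℚ), M + P = n →
    ∀ r : KZ.IntegralRep 2, r.domain = KZ.unitCube 2 → Set.EqOn r.integrand (fun x => (q : ℝ) *
      (x 0 ^ a * x 1 ^ b * (1 - x 0) ^ P * (1 - x 1) ^ R * (1 - x 0 * x 1) ^ (M : ℤ))) (KZ.unitCube 2) →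
      KZ.of r ∈ G := by
  intro n
  induction n using Nat.strong_induction_on with
  | _ n ih =>
  intro M P a b R q hn
  have ha : (a : ℝ) + 1 ≠ 0 := by positivity
  -- the divergence `d = ∂₀ h₀`
  obtain ⟨r, hrd, hri⟩ := facesTwo_rep_sub (facesTwo_rep_sub (facesTwo_rep_gen q a b P R M (by omega))
    (facesTwo_rep_gen (q / ((a : ℚ) + 1) * P) (a + 1) b (P - 1) R M (by omega)))
    (facesTwo_rep_gen (q / ((a : ℚ) + 1) * M) (a + 1) (b + 1) P R ((M : ℤ) - 1) (by omega))
  have hr : KZ.of r ∈ G := by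
    refine facesTwo_stokes hStokes hG hC1 (q / ((a : ℚ) + 1)) (a + 1) b P R (M : ℤ) 0 0 0 0 0 0
      (by omega) (by norm_num) (Or.inr (by omega)) (Or.inr (by norm_num)) r hrd fun x hx => ?_
    rw [hri hx]
    simp only [Nat.add_sub_cancel]
    push_cast
    field_simp
    ring
  have hd := facesTwo_good_congr hG hrd hri hr
  -- the two remainders
  have hg₁ : ∀ r : KZ.IntegralRep 2, r.domain = KZ.unitCube 2 → Set.EqOn r.integrand
      (fun x => ((q / ((a : ℚ) + 1) * P : ℚ) : ℝ) * (x 0 ^ (a + 1) * x 1 ^ b * (1 - x 0) ^ (P - 1) *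
        (1 - x 1) ^ R * (1 - x 0 * x 1) ^ (M : ℤ))) (KZ.unitCube 2) → KZ.of r ∈ G := by
    rcases Nat.eq_zero_or_pos P with rfl | hP
    · exact facesTwo_good_of_eqOn_zero hG fun x _ => by simp
    · obtain ⟨P', rfl⟩ : ∃ P', P = P' + 1 := ⟨P - 1, by omega⟩
      simp only [Nat.add_sub_cancel]
      exact ih (M + P') (by omega) M P' (a + 1) b R _ rfl
  have hg₂ : ∀ r : KZ.IntegralRep 2, r.domain = KZ.unitCube 2 → Set.EqOn r.integrand
      (fun x => ((q / ((a : ℚ) + 1) * M : ℚ) : ℝ) * (x 0 ^ (a + 1) * x 1 ^ (b + 1) * (1 - x 0) ^ P *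
        (1 - x 1) ^ R * (1 - x 0 * x 1) ^ ((M : ℤ) - 1))) (KZ.unitCube 2) → KZ.of r ∈ G := by
    rcases Nat.eq_zero_or_pos M with rfl | hM
    · exact facesTwo_good_of_eqOn_zero hG fun x _ => by simp
    · obtain ⟨M', rfl⟩ : ∃ M', M = M' + 1 := ⟨M - 1, by omega⟩
      have e : ((M' + 1 : ℕ) : ℤ) - 1 = (M' : ℤ) := by push_cast; ring
      rw [e]
      exact ih (M' + P) (by omega) M' P (a + 1) (b + 1) R _ rfl
  refine facesTwo_good_add3 hG hd hg₁ hg₂ ⟨r, hrd, hri⟩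
    (facesTwo_rep_gen _ _ _ _ _ _ (by omega)) (facesTwo_rep_gen _ _ _ _ _ _ (by omega))
    fun x _ => ?_
  ring

include hStokes hG hC1 in
/-- Atoms with `m ≥ 0` are GOOD. -/
theorem facesTwo_good_nonneg (m : ℤ) (hm : 0 ≤ m) : ∀ (a b P R : ℕ) (q : ℚ),
    ∀ r : KZ.IntegralRep 2, r.domain = KZ.unitCube 2 → Set.EqOn r.integrand (fun x => (q : ℝ) *
      (x 0 ^ a * x 1 ^ b * (1 - x 0) ^ P * (1 - x 1) ^ R * (1 - x 0 * x 1) ^ m)) (KZ.unitCube 2) →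
      KZ.of r ∈ G := by
  obtain ⟨M, rfl⟩ := Int.eq_ofNat_of_zero_le hm
  intro a b P R q
  exact facesTwo_good_poly hStokes hG hC1 (M + P) M P a b R q rfl

/-! ### Pole order one -/

include hG hL in
/-- **`T₀ = q/(1-x₀x₁)` is GOOD**: the cubical chart `(x₀, x₁) ↦ (x₀, x₀x₁)` onto the open
simplex is ONE change-of-variables move to the `ζ(2)` word `[Δ₂, q/(t₀(1-t₁))]`
(`TwoPosets.stub_cubicalChart`). [cite: KontsevichZagier2001, §1.2 rule (2)] -/
theorem facesTwo_good_T0 (q : ℚ) :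
    ∀ r : KZ.IntegralRep 2, r.domain = KZ.unitCube 2 → Set.EqOn r.integrand (fun x => (q : ℝ) *
      (x 0 ^ 0 * x 1 ^ 0 * (1 - x 0) ^ 0 * (1 - x 1) ^ 0 * (1 - x 0 * x 1) ^ (-1 : ℤ))) (KZ.unitCube 2) →
      KZ.of r ∈ G := by
  intro r hrd hri
  have h := (stub_cubicalChart 2 ω2 adm_ω2 q).2 r hrd fun x hx => ?_
  · have e : KZ.of r = -(KZ.of (wordRep ω2 q adm_ω2) - KZ.of r) + KZ.of (wordRep ω2 q adm_ω2) := by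
      abel
    rw [e]
    exact add_mem (neg_mem (hG h)) (hL q)
  · have hx' : x ∈ KZ.unitCube 2 := hx
    rw [hri hx']
    have h0 : x 0 ≠ 0 := (hx' 0).1.ne'
    have hw : 1 - x 0 * x 1 ≠ 0 := (facesTwo_w_pos hx').ne'
    have hp1 : pprod x 1 = x 0 * x 1 := by simpa [pprod_zero] using pprod_succ x 0
    simp [cubicalFun, wordFun, cubicalMap, Summit.KontsevichZagierPeriods.MzvKernelInKZ.Negative.ω2,
      Fin.prod_univ_two, pprod_zero, hp1]
    field_simp

include hStokes hG hC1 hL in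
/-- **`T_c = q x₀^c/(1-x₀x₁)` is GOOD** for every `c`: induction on `c`. For `c + 1`, ONE
Stokes move with `h₀ = GEN(k, c+1, 0, 1, 0, -1) = k x₀^{c+1}(1-x₀)/(1-x₀x₁)` and
`h₁ = GEN(k, c, 0, 0, 1, -1) = k x₀^c(1-x₁)/(1-x₀x₁)`, `k = -q/(c+1)` (both bounded by `|k|` on the
closed square, faces `0, 0, k x₀^c, 0`), whose divergence is `q T_{c+1} - (qc/(c+1)) T_c`: the
second-order poles cancel. [cite: KontsevichZagier2001, §1.2 rule (3)] -/
theorem facesTwo_good_T : ∀ (c : ℕ) (q : ℚ),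
    ∀ r : KZ.IntegralRep 2, r.domain = KZ.unitCube 2 → Set.EqOn r.integrand (fun x => (q : ℝ) *
      (x 0 ^ c * x 1 ^ 0 * (1 - x 0) ^ 0 * (1 - x 1) ^ 0 * (1 - x 0 * x 1) ^ (-1 : ℤ))) (KZ.unitCube 2) →
      KZ.of r ∈ G := by
  intro c
  induction c with
  | zero => exact fun q => facesTwo_good_T0 hG hL q
  | succ c ih =>
    intro q
    have hc : (c : ℝ) + 1 ≠ 0 := by positivity
    -- the divergence `d = q T_{c+1} - (qc/(c+1)) T_c`
    obtain ⟨r, hrd, hri⟩ := facesTwo_rep_add (facesTwo_rep_gen q (c + 1) 0 0 0 (-1) (by norm_num))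
      (facesTwo_rep_gen (-(q * c / ((c : ℚ) + 1))) c 0 0 0 (-1) (by norm_num))
    have hr : KZ.of r ∈ G := by
      refine facesTwo_stokes hStokes hG hC1 (-q / ((c : ℚ) + 1)) (c + 1) 0 1 0 (-1)
        (-q / ((c : ℚ) + 1)) c 0 0 1 (-1) (by norm_num) (by norm_num) (Or.inl le_rfl)
        (Or.inl le_rfl) r hrd fun x hx => ?_
      rw [hri hx]
      have hw : 1 - x 0 * x 1 ≠ 0 := (facesTwo_w_pos hx).ne'
      have e2 : (-1 - 1 : ℤ) = -2 := by norm_num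
      simp only [Nat.add_sub_cancel, Nat.sub_self, Nat.zero_sub, e2, zpow_neg, zpow_ofNat]
      push_cast
      field_simp
      ring
    have hd := facesTwo_good_congr hG hrd hri hr
    refine facesTwo_good_add hG hd (ih (q * c / ((c : ℚ) + 1))) ⟨r, hrd, hri⟩
      (facesTwo_rep_gen _ _ _ _ _ _ (by norm_num)) fun x _ => ?_
    push_cast
    ring

include hStokes hG hC1 hL in
/-- **`W(a, b) = q x₀^a x₁^b/(1-x₀x₁)` is GOOD**: induction on `b`; `W(a, 0) = T_a`,
`W(0, b) = T_b` read through `x₀ ↔ x₁`, and `W(a+1, b+1) = W(a, b) - q x₀^a x₁^b`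
(`x₀x₁ = 1 - (1 - x₀x₁)`, integrand additivity). [cite: KontsevichZagier2001, §1.2 rule (1)] -/
theorem facesTwo_good_W : ∀ (b a : ℕ) (q : ℚ),
    ∀ r : KZ.IntegralRep 2, r.domain = KZ.unitCube 2 → Set.EqOn r.integrand (fun x => (q : ℝ) *
      (x 0 ^ a * x 1 ^ b * (1 - x 0) ^ 0 * (1 - x 1) ^ 0 * (1 - x 0 * x 1) ^ (-1 : ℤ))) (KZ.unitCube 2) →
      KZ.of r ∈ G := by
  intro b
  induction b with
  | zero => exact fun a q => facesTwo_good_T hStokes hG hC1 hL a q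
  | succ b ih =>
    intro a q
    cases a with
    | zero =>
      exact facesTwo_good_swap hG q (b + 1) 0 0 0 (-1) (facesTwo_good_T hStokes hG hC1 hL _ q)
    | succ a =>
      refine facesTwo_good_add hG (ih a q) (facesTwo_good_nonneg hStokes hG hC1 0 le_rfl a b 0 0 (-q))
        (facesTwo_rep_gen _ _ _ _ _ _ (by norm_num)) (facesTwo_rep_gen _ _ _ _ _ _ (by norm_num))
        fun x hx => ?_
      have hw : 1 - x 0 * x 1 ≠ 0 := (facesTwo_w_pos hx).ne'
      simp only [zpow_neg, zpow_one, zpow_zero]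
      push_cast
      field_simp
      ring

include hStokes hG hC1 hL in
/-- All atoms `q x₀^a x₁^b (1-x₁)^R/(1-x₀x₁)` are GOOD: induction on `R`,
`(1-x₁)^{R+1} = (1-x₁)^R - x₁(1-x₁)^R`. [cite: KontsevichZagier2001, §1.2 rule (1)] -/
theorem facesTwo_good_m1R : ∀ (R a b : ℕ) (q : ℚ),
    ∀ r : KZ.IntegralRep 2, r.domain = KZ.unitCube 2 → Set.EqOn r.integrand (fun x => (q : ℝ) *
      (x 0 ^ a * x 1 ^ b * (1 - x 0) ^ 0 * (1 - x 1) ^ R * (1 - x 0 * x 1) ^ (-1 : ℤ))) (KZ.unitCube 2) →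
      KZ.of r ∈ G := by
  intro R
  induction R with
  | zero => exact fun a b q => facesTwo_good_W hStokes hG hC1 hL b a q
  | succ R ih =>
    intro a b q
    refine facesTwo_good_add hG (ih a b q) (ih a (b + 1) (-q))
      (facesTwo_rep_gen _ _ _ _ _ _ (by omega)) (facesTwo_rep_gen _ _ _ _ _ _ (by omega))
      fun x _ => ?_
    push_cast
    ring

include hStokes hG hC1 hL in
/-- **All atoms of pole order one** `q x₀^a x₁^b (1-x₀)^P (1-x₁)^R/(1-x₀x₁)` **are GOOD**:
induction on `P`, `(1-x₀)^{P+1} = (1-x₀)^P - x₀(1-x₀)^P`.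
[cite: KontsevichZagier2001, §1.2 rule (1)] -/
theorem facesTwo_good_m1 : ∀ (P R a b : ℕ) (q : ℚ),
    ∀ r : KZ.IntegralRep 2, r.domain = KZ.unitCube 2 → Set.EqOn r.integrand (fun x => (q : ℝ) *
      (x 0 ^ a * x 1 ^ b * (1 - x 0) ^ P * (1 - x 1) ^ R * (1 - x 0 * x 1) ^ (-1 : ℤ))) (KZ.unitCube 2) →
      KZ.of r ∈ G := by
  intro P
  induction P with
  | zero => exact fun R a b q => facesTwo_good_m1R hStokes hG hC1 hL R a b q
  | succ P ih =>
    intro R a b q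
    refine facesTwo_good_add hG (ih R a b q) (ih R (a + 1) b (-q))
      (facesTwo_rep_gen _ _ _ _ _ _ (by omega)) (facesTwo_rep_gen _ _ _ _ _ _ (by omega))
      fun x _ => ?_
    push_cast
    ring

/-! ### Registered sub-goal -/

/-- Registered sub-goal `stub_exactToFacesTwoAux4` of this file: `[□², q/(1-x₀x₁)]` lies in every
subgroup containing the relations and the `ζ(2)` words (`facesTwo_good_T0`, the cubical chart). -/
theorem stub_exactToFacesTwoAux4 : ∀ (G : AddSubgroup Literature.NumberTheory.Transcendental.KZ.FormalRep), Literature.NumberTheory.Transcendental.KZ.relations ≤ G → (∀ q : ℚ, Literature.NumberTheory.Transcendental.KZ.of (Summit.KontsevichZagierPeriods.MzvKernelInKZ.Negative.wordRep Summit.KontsevichZagierPeriods.MzvKernelInKZ.Negative.ω2 q Summit.KontsevichZagierPeriods.MzvKernelInKZ.Negative.adm_ω2) ∈ G) → ∀ (q : ℚ) (r : Literature.NumberTheory.Transcendental.KZ.IntegralRep 2), r.domain = {x : Fin 2 → ℝ | ∀ i, x i ∈ Set.Ioo (0:ℝ) 1} → Set.EqOn r.integrand (fun x : Fin 2 → ℝ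 => (q : ℝ) * (x 0 ^ (0:ℕ) * x 1 ^ (0:ℕ) * (1 - x 0) ^ (0:ℕ) * (1 - x 1) ^ (0:ℕ) * (1 - x 0 * x 1) ^ (-1:ℤ))) {x : Fin 2 → ℝ | ∀ i, x i ∈ Set.Ioo (0:ℝ) 1} → Literature.NumberTheory.Transcendental.KZ.of r ∈ G :=
  fun _ hG hL q r hrd hri => facesTwo_good_T0 hG hL q r hrd hri

end Summit.KontsevichZagierPeriods.DihedralNormalForm.TameBVStokes
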